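import Mathlib.Tactic.Linarith
import Summits.Ventures.PercRepro.MSTightDichotomy

/-!
# The Daykin lever: the larger half of a tight family is tight

For a family `F` and an element `r` let `F₀ = part0 r F` (members avoiding `r`) and
`L = partr r F` (members containing `r`, with `r` removed), `X = diffsX r F` (the `r`-free
differences) and `Y = diffsY r F = L \\ F₀` (the differences containing `r`, with `r` removed),
so that `|F \\ F| = |X| + |Y|` (`card_diffs_eq_card_X_add_card_Y`). Daykin's two-family form of
the Marica–Schönheim inequality (`Finset.le_card_diffs_mul_card_diffs`, Mathlib) reads
`|L| · |F₀| ≤ |L \\ F₀| · |F₀ \\ L| = |Y| · |F₀ \\ L| ≤ |Y| · |X|`.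
If `F` is TIGHT (`|F \\ F| = |F| = |F₀| + |L|`) and `|L| ≤ |F₀|`, then — because `|X| ≥ |F₀ \\ F₀|
≥ |F₀|` (Marica–Schönheim) and `x ↦ x (|F₀| + |L| − x)` is decreasing beyond `|F₀|` — the only
possibility is `|X| = |F₀|`, `|Y| = |L|`; hence (`tight_part0_of_card_le`) `F₀` is tight with
`F₀ \\ F₀ = X`, and (`sdiff_part0_partr_eq_diffsX`, when `L ≠ ∅`) `F₀ \\ L = X` too. By the
complement symmetry the same holds for `L` when `|F₀| ≤ |L|`.

No hypothesis on `F \\ F` is needed: this is the unconditional first step (Lemma B1) of the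
proof of Theorem S in proofs/MINE1-singlemerge.md §17.3 — `MSTightDichotomy.lean` obtains the twin
dichotomy from the same inequality under the extra hypothesis that `F \\ F` is a down-set.
-/

namespace PercRepro.MSTight

open Finset
open scoped FinsetFamily

variable {α : Type*} [DecidableEq α]

/-- `F₀ \\ L ⊆ X`: a difference of an `r`-free member and an `r`-member (with `r` removed) is an
`r`-free difference. -/
theorem sdiff_part0_partr_subset_diffsX (r : α) (F : Finset (Finset α)) :
    part0 r F \\ partr r F ⊆ diffsX r F :=
  fun _ hE => Finset.mem_union.2 (Or.inr hE)

/-- `F₀ \\ F₀ ⊆ X`. -/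
theorem diffs_part0_subset_diffsX (r : α) (F : Finset (Finset α)) :
    part0 r F \\ part0 r F ⊆ diffsX r F :=
  fun _ hE => Finset.mem_union.2 (Or.inl (Finset.mem_union.2 (Or.inl hE)))

/-- **The Daykin lever.** If `F` is tight and at most as many members contain `r` as avoid it,
then the `r`-free differences number exactly `|F₀|` (and the `r`-differences exactly `|L|`). -/
theorem card_diffsX_eq_card_part0_of_card_le {F : Finset (Finset α)} (hF : Tight F) (r : α)
    (h : (partr r F).card ≤ (part0 r F).card) :
    (diffsX r F).card = (part0 r F).card ∧ (diffsY r F).card = (partr r F).card := by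
  set p := (part0 r F).card with hp
  set q := (partr r F).card with hq
  set x := (diffsX r F).card with hx
  set y := (diffsY r F).card with hy
  have hsum : x + y = p + q := by
    rw [hx, hy, ← card_diffs_eq_card_X_add_card_Y, hF, card_eq_card_part0_add_card_partr r F]
  have hxp : p ≤ x := by
    rw [hp, hx]
    exact (Finset.card_le_card_diffs _).trans (Finset.card_le_card (diffs_part0_subset_diffsX r F))
  have hdaykin : q * p ≤ y * x := by
    have h1 := Finset.le_card_diffs_mul_card_diffs (partr r F) (part0 r F)
    have h2 : (part0 r F \\ partr r F).card ≤ x := by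
      rw [hx]; exact Finset.card_le_card (sdiff_part0_partr_subset_diffsX r F)
    calc q * p = (partr r F).card * (part0 r F).card := by rw [hq, hp]
      _ ≤ (partr r F \\ part0 r F).card * (part0 r F \\ partr r F).card := h1
      _ = y * (part0 r F \\ partr r F).card := by rw [hy]; rfl
      _ ≤ y * x := Nat.mul_le_mul_left _ h2
  -- from x + y = p + q, q ≤ p ≤ x and q p ≤ y x: (x − p)(x − q) ≤ 0, hence x = p
  have hxeq : x = p := by
    have hy' : y = p + q - x := by omega
    rw [hy'] at hdaykin
    have hx' : x ≤ p + q := by omega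
    -- q p ≤ (p + q − x) x with x ≥ p ≥ q forces x = p
    rcases Nat.lt_or_ge p x with hlt | hge
    · exfalso
      have : (p + q - x) * x < q * p := by
        have e : p + q - x + x = p + q := by omega
        have hqx : q ≤ x := h.trans hxp
        -- (p+q-x) x < q p ⇔ ... use nlinarith on naturals via casts
        have : (p + q - x) < q := by omega
        nlinarith [Nat.sub_add_cancel hx', this, hlt, hqx]
      omega
    · omega
  exact ⟨hxeq, by omega⟩

/-- **The larger half is tight**: if `F` is tight and `|L| ≤ |F₀|`, then `F₀ = part0 r F` is tight
and its difference family is exactly the family of `r`-free differences of `F`. -/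
theorem tight_part0_of_card_le {F : Finset (Finset α)} (hF : Tight F) (r : α)
    (h : (partr r F).card ≤ (part0 r F).card) :
    Tight (part0 r F) ∧ part0 r F \\ part0 r F = diffsX r F := by
  obtain ⟨hx, _⟩ := card_diffsX_eq_card_part0_of_card_le hF r h
  have hsub := diffs_part0_subset_diffsX r F
  have hcard : (diffsX r F).card ≤ (part0 r F \\ part0 r F).card := by
    rw [hx]; exact Finset.card_le_card_diffs _
  have heq : part0 r F \\ part0 r F = diffsX r F := Finset.eq_of_subset_of_card_le hsub hcard
  refine ⟨?_, heq⟩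
  show (part0 r F \\ part0 r F).card = (part0 r F).card
  rw [heq, hx]

/-- When moreover some member contains `r`, every `r`-free difference is a difference of an
`r`-free member and an `r`-member: `F₀ \\ L = X`. -/
theorem sdiff_part0_partr_eq_diffsX {F : Finset (Finset α)} (hF : Tight F) (r : α)
    (h : (partr r F).card ≤ (part0 r F).card) (hne : (partr r F).Nonempty) :
    part0 r F \\ partr r F = diffsX r F := by
  obtain ⟨hx, hy⟩ := card_diffsX_eq_card_part0_of_card_le hF r h
  have hq : 0 < (partr r F).card := Finset.card_pos.2 hne
  have h1 := Finset.le_card_diffs_mul_card_diffs (partr r F) (part0 r F)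
  -- `|L| |F₀| ≤ |Y| |F₀ \\ L| = |L| |F₀ \\ L|`, so `|F₀| ≤ |F₀ \\ L|`
  have h2 : (part0 r F).card ≤ (part0 r F \\ partr r F).card := by
    have : (partr r F).card * (part0 r F).card ≤ (partr r F).card * (part0 r F \\ partr r F).card := by
      calc (partr r F).card * (part0 r F).card
          ≤ (partr r F \\ part0 r F).card * (part0 r F \\ partr r F).card := h1
        _ = (partr r F).card * (part0 r F \\ partr r F).card := by
          rw [show partr r F \\ part0 r F = diffsY r F from rfl, hy]
    exact Nat.le_of_mul_le_mul_left this hq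
  apply Finset.eq_of_subset_of_card_le (sdiff_part0_partr_subset_diffsX r F)
  rw [hx]; exact h2

end PercRepro.MSTight
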